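import Mathlib.Analysis.InnerProductSpace.Basic
import HarnessLib

/-!
# Near-extremal numerical range of a sum of isometries forces a common near-eigenphase

Elementary inner-product-space facts used in Lifshitz-tail / flat-section arguments for lattice hopping operators
(a hopping operator `K = Σ_μ W_μ` is a sum of `m` unitaries; a vector at which the numerical range of `K` nearly
reaches its ceiling `m` is a near-eigenvector of every `W_μ` with ONE common unit eigenvalue):

* `exists_unit_phase_aligned` — for every `Z ∈ ℂ` a unit `u` with `Re(ū Z) = |Z|`;
* `norm_sub_phase_smul_sq_le_of_sum_inner` — if `‖φ_i‖ = ‖ψ‖` (`i ∈ s`, `|s| = m`) and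
  `m(1 − θ)‖ψ‖² ≤ |Σ_i ⟨ψ, φ_i⟩|`, then some unit `u` has `‖φ_i − uψ‖² ≤ 2mθ‖ψ‖²` for all `i`
  (`Z = Σ⟨ψ,φ_i⟩`, `u = Z/|Z|`; `Re(ū⟨ψ,φ_i⟩) ≥ |Z| − (m−1)‖ψ‖²`; `‖φ_i − uψ‖² = 2‖ψ‖² − 2Re(ū⟨ψ,φ_i⟩)`);
* `abs_norm_sub_norm_le_norm_sub_of_norm_eq` — Kato's inequality for a norm-preserving transport;
* `norm_sub_map_comp_le_telescope` — the four-link telescoping bound for a holonomy defect.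

All statements are standard linear algebra (numerical range, Kato's inequality); no single source. [folklore]
-/

namespace Literature.Analysis.InnerProduct

open scoped ComplexConjugate InnerProductSpace
open Complex

variable {E : Type*} [NormedAddCommGroup E] [InnerProductSpace ℂ E]
/-- A unit complex number `u` aligned with `Z`: `‖u‖ = 1` and `Re(ū Z) = ‖Z‖` (take `u = Z/‖Z‖`, or `u = 1` if `Z = 0`). [folklore] -/
theorem exists_unit_phase_aligned (Z : ℂ) :
    ∃ u : ℂ, ‖u‖ = 1 ∧ (conj u * Z).re = ‖Z‖ := by
  by_cases hZ : Z = 0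
  · exact ⟨1, by simp, by simp [hZ]⟩
  · have hn : ‖Z‖ ≠ 0 := norm_ne_zero_iff.mpr hZ
    refine ⟨Z / (‖Z‖ : ℂ), ?_, ?_⟩
    · rw [norm_div, Complex.norm_real, Real.norm_eq_abs, abs_of_nonneg (norm_nonneg _), div_self hn]
    · have h : conj (Z / (‖Z‖ : ℂ)) * Z = ((‖Z‖ : ℝ) : ℂ) := by
        rw [map_div₀, Complex.conj_ofReal, div_mul_eq_mul_div, ← Complex.normSq_eq_conj_mul_self,
          Complex.normSq_eq_norm_sq, div_eq_iff (Complex.ofReal_ne_zero.mpr hn)]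
        push_cast
        ring
      rw [h, Complex.ofReal_re]

/-- **Common near-eigenphase from a near-extremal numerical range.**
Let `φ_i` (`i ∈ s`, `m = |s|`) be vectors with `‖φ_i‖ = ‖ψ‖` (e.g. `φ_i = W_i ψ` for isometries `W_i`).  If
`m(1 − θ)‖ψ‖² ≤ |Σ_{i∈s} ⟨ψ, φ_i⟩|`, then there is a unit complex number `u` with `‖φ_i − u ψ‖² ≤ 2mθ‖ψ‖²` for every
`i ∈ s`.  (For the Wilson hopping operator `m = 4`: `|⟨ψ, K_Uψ⟩| ≥ 4(1−θ)‖ψ‖² ⇒ ‖W_μψ − uψ‖² ≤ 8θ‖ψ‖²` for all `μ`.) [folklore] -/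
theorem norm_sub_phase_smul_sq_le_of_sum_inner {ι : Type*} [DecidableEq ι] (s : Finset ι) (φ : ι → E) (ψ : E)
    (θ : ℝ) (hiso : ∀ i ∈ s, ‖φ i‖ = ‖ψ‖)
    (hsum : (s.card : ℝ) * (1 - θ) * ‖ψ‖ ^ 2 ≤ ‖∑ i ∈ s, ⟪ψ, φ i⟫_ℂ‖) :
    ∃ u : ℂ, ‖u‖ = 1 ∧ ∀ i ∈ s, ‖φ i - u • ψ‖ ^ 2 ≤ 2 * s.card * θ * ‖ψ‖ ^ 2 := by
  set Z : ℂ := ∑ i ∈ s, ⟪ψ, φ i⟫_ℂ with hZdef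
  obtain ⟨u, hu, huZ⟩ := exists_unit_phase_aligned Z
  refine ⟨u, hu, fun i hi => ?_⟩
  -- `|⟨ψ, φ_j⟩| ≤ ‖ψ‖²`
  have hzj : ∀ j ∈ s, ‖⟪ψ, φ j⟫_ℂ‖ ≤ ‖ψ‖ ^ 2 := fun j hj => by
    calc ‖⟪ψ, φ j⟫_ℂ‖ ≤ ‖ψ‖ * ‖φ j‖ := norm_inner_le_norm ψ (φ j)
      _ = ‖ψ‖ ^ 2 := by rw [hiso j hj, sq]
  -- split the sum at `i`
  have hsplit : Z = ⟪ψ, φ i⟫_ℂ + ∑ j ∈ s.erase i, ⟪ψ, φ j⟫_ℂ :=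
    (Finset.add_sum_erase s (fun j => ⟪ψ, φ j⟫_ℂ) hi).symm
  -- the tail is at most `(m − 1)‖ψ‖²`
  have htail : ‖conj u * ∑ j ∈ s.erase i, ⟪ψ, φ j⟫_ℂ‖ ≤ ((s.card : ℝ) - 1) * ‖ψ‖ ^ 2 := by
    rw [norm_mul, Complex.norm_conj, hu, one_mul]
    calc ‖∑ j ∈ s.erase i, ⟪ψ, φ j⟫_ℂ‖ ≤ ∑ j ∈ s.erase i, ‖⟪ψ, φ j⟫_ℂ‖ := norm_sum_le _ _
      _ ≤ ∑ _j ∈ s.erase i, ‖ψ‖ ^ 2 := Finset.sum_le_sum fun j hj => hzj j (Finset.mem_of_mem_erase hj)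
      _ = ((s.card : ℝ) - 1) * ‖ψ‖ ^ 2 := by
          rw [Finset.sum_const, nsmul_eq_mul, Finset.card_erase_of_mem hi, Nat.cast_sub (Finset.card_pos.mpr ⟨i, hi⟩)]
          push_cast
          ring
  -- hence `Re(ū⟨ψ,φ_i⟩) ≥ ‖Z‖ − (m − 1)‖ψ‖²`
  have hre : ‖Z‖ - ((s.card : ℝ) - 1) * ‖ψ‖ ^ 2 ≤ (conj u * ⟪ψ, φ i⟫_ℂ).re := by
    have h1 : (conj u * Z).re = (conj u * ⟪ψ, φ i⟫_ℂ).re + (conj u * ∑ j ∈ s.erase i, ⟪ψ, φ j⟫_ℂ).re := by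
      rw [hsplit, mul_add, Complex.add_re]
    have h2 : (conj u * ∑ j ∈ s.erase i, ⟪ψ, φ j⟫_ℂ).re ≤ ((s.card : ℝ) - 1) * ‖ψ‖ ^ 2 :=
      (Complex.re_le_norm _).trans htail
    linarith [huZ]
  -- `‖φ_i − uψ‖² = 2‖ψ‖² − 2 Re(ū⟨ψ,φ_i⟩)`
  have hexp : ‖φ i - u • ψ‖ ^ 2 = 2 * ‖ψ‖ ^ 2 - 2 * (conj u * ⟪ψ, φ i⟫_ℂ).re := by
    have h := @norm_sub_sq ℂ E _ _ _ (φ i) (u • ψ)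
    rw [norm_smul, hu, one_mul, hiso i hi, inner_smul_right] at h
    have hswap : (RCLike.re (u * ⟪φ i, ψ⟫_ℂ) : ℝ) = (conj u * ⟪ψ, φ i⟫_ℂ).re := by
      have : conj (u * ⟪φ i, ψ⟫_ℂ) = conj u * ⟪ψ, φ i⟫_ℂ := by
        rw [map_mul, inner_conj_symm]
      rw [← this, Complex.conj_re]
      rfl
    rw [h, hswap]
    ring
  rw [hexp]
  nlinarith [hre, hsum, norm_nonneg Z]

/-- **Kato's inequality for a norm-preserving parallel transport.**  If `‖G b‖ = ‖b‖` (e.g. `G` unitary), then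
`|‖a‖ − ‖b‖| ≤ ‖a − G b‖`: the modulus of a flat section of a unitary connection has small ordinary gradient. [folklore] -/
theorem abs_norm_sub_norm_le_norm_sub_of_norm_eq {F : Type*} [SeminormedAddCommGroup F] (a b Gb : F) (hG : ‖Gb‖ = ‖b‖) :
    |‖a‖ - ‖b‖| ≤ ‖a - Gb‖ := by
  rw [← hG]
  exact abs_norm_sub_norm_le a Gb

/-- **Telescoping around a 4-cycle of norm-preserving transports.**  The holonomy defect at the base point of a
lattice plaquette is controlled by the four link defects: for vectors `ψ₀ ψ₁ ψ₂ ψ₃ ψ₀' : F` and norm-preserving additive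
maps `T₁ T₂ T₃ : F →+ F` (the fourth transport is folded into `ψ₀'`),
`‖ψ₀ − T₁ (T₂ (T₃ ψ₀'))‖ ≤ ‖ψ₀ − T₁ ψ₁‖ + ‖ψ₁ − T₂ ψ₂‖ + ‖ψ₂ − T₃ ψ₃‖ + ‖ψ₃ − ψ₀'‖`. [folklore] -/
theorem norm_sub_map_comp_le_telescope {F : Type*} [SeminormedAddCommGroup F] (T₁ T₂ T₃ : F →+ F)
    (h₁ : ∀ v, ‖T₁ v‖ = ‖v‖) (h₂ : ∀ v, ‖T₂ v‖ = ‖v‖) (h₃ : ∀ v, ‖T₃ v‖ = ‖v‖)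
    (ψ₀ ψ₁ ψ₂ ψ₃ ψ₀' : F) :
    ‖ψ₀ - T₁ (T₂ (T₃ ψ₀'))‖ ≤ ‖ψ₀ - T₁ ψ₁‖ + ‖ψ₁ - T₂ ψ₂‖ + ‖ψ₂ - T₃ ψ₃‖ + ‖ψ₃ - ψ₀'‖ := by
  have e : ψ₀ - T₁ (T₂ (T₃ ψ₀')) =
      (ψ₀ - T₁ ψ₁) + T₁ (ψ₁ - T₂ ψ₂) + T₁ (T₂ (ψ₂ - T₃ ψ₃)) + T₁ (T₂ (T₃ (ψ₃ - ψ₀'))) := by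
    simp only [map_sub]
    abel
  rw [e]
  calc ‖(ψ₀ - T₁ ψ₁) + T₁ (ψ₁ - T₂ ψ₂) + T₁ (T₂ (ψ₂ - T₃ ψ₃)) + T₁ (T₂ (T₃ (ψ₃ - ψ₀')))‖
      ≤ ‖ψ₀ - T₁ ψ₁‖ + ‖T₁ (ψ₁ - T₂ ψ₂)‖ + ‖T₁ (T₂ (ψ₂ - T₃ ψ₃))‖ + ‖T₁ (T₂ (T₃ (ψ₃ - ψ₀')))‖ := by
        have h1 := norm_add_le ((ψ₀ - T₁ ψ₁) + T₁ (ψ₁ - T₂ ψ₂) + T₁ (T₂ (ψ₂ - T₃ ψ₃)))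
          (T₁ (T₂ (T₃ (ψ₃ - ψ₀'))))
        have h2 := norm_add_le ((ψ₀ - T₁ ψ₁) + T₁ (ψ₁ - T₂ ψ₂)) (T₁ (T₂ (ψ₂ - T₃ ψ₃)))
        have h3 := norm_add_le (ψ₀ - T₁ ψ₁) (T₁ (ψ₁ - T₂ ψ₂))
        linarith
    _ = ‖ψ₀ - T₁ ψ₁‖ + ‖ψ₁ - T₂ ψ₂‖ + ‖ψ₂ - T₃ ψ₃‖ + ‖ψ₃ - ψ₀'‖ := by rw [h₁, h₁, h₂, h₁, h₂, h₃]

end Literature.Analysis.InnerProduct
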